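import Literature.AnabelianGeometry.AbsoluteAnabelian.AbsTopI.ChainTransportOps
import Literature.AnabelianGeometry.AbsoluteAnabelian.AbsTopI.ChainTransportCusp
import Literature.AnabelianGeometry.AbsoluteAnabelian.AbsTopI.SemiAbsoluteChainsProofs
import HarnessLib

/-!
# [AbsTopI] Theorem 4.7 (ii) PROVED for Π-chains: transport of chains along `φ`

Proof-only conclusion of the transport-of-structure argument ([AbsTopI] Thm 4.7 (ii) p. 57, printed
proof p. 58 "the definitions of the various categories involved are entirely group-theoretic"): every
`Π_E`-chain is `φ`-isomorphic to a `Π_F`-chain (`exists_isoOver`, built from `transportTerms` /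
`transportTermsIso` of `ChainTransport.lean` and the transfer of all four elementary operations), in
particular every `ÉtLoc(Π_E)`-object to an `ÉtLoc(Π_F)`-object (`exists_isoOver_of_isEtLocObj`), and
`thm_4_7_ii_holds : AbsTopI.Thm_4_7_ii` — the named fact of `SemiAbsoluteChains.lean` is DISCHARGED.
No definitions. [cite: MochizukiAbsTopI2012, Thm 4.7 (ii) p.57]
-/

noncomputable section

open CategoryTheory Topology
open scoped Pointwise

universe u

namespace Literature.AnabelianGeometry.AbsoluteAnabelian.AbsTopI

open Literature.AlgebraicGeometry.Frobenioids (IsSlimGroup)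
open FundamentalExtension

variable {E F : FundamentalExtension.{u}}

/-! ### Transport of an arbitrary chain -/

section Full

variable (φ) {C₁ : CuspidalData E} {hP₁ : IsSlimGroup E.arith} {hΔ₁ : IsSlimGroup E.geom}
  {hne₁ : E.geom ≠ ⊥}

/-- The canonical term isomorphisms of `ChainTransportEtLoc.transportTermsIso` are strict.
[cite: MochizukiAbsTopI2012, Thm 4.7 (ii) p.57] -/
theorem transportTermsIso_isStrict (T : TargetData F) (c : E.PiChain C₁ hP₁ hΔ₁ hne₁) :
    ∀ j, (transportTermsIso φ T c j).IsStrict :=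
  Fin.cases (isoOfEqSelf_isStrict c.term_zero T) fun j => transportTermIso_isStrict (c.term j.succ)

/-- Every elementary operation transfers along the canonical term isomorphisms, given corresponding
cuspidal data. [cite: MochizukiAbsTopI2012, Thm 4.7 (ii) p.57] -/
theorem isElemOp_transfer_all {C₂ : CuspidalData F} (hC : CuspidalDataCompat φ C₁ C₂)
    {t : ElemOpType} {L L' : E.ChainGroup} {M M' : F.ChainGroup} (I : ChainGroupIsoOver φ L M)
    (hI : I.IsStrict) (I' : ChainGroupIsoOver φ L' M') (h : ChainGroup.IsElemOp C₁ t L L') :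
    ChainGroup.IsElemOp C₂ t M M' := by
  cases t with
  | finEtCov => exact isElemOp_finEtCov_transfer I I' h
  | finEtQuot => exact isElemOp_finEtQuot_transfer I I' h
  | deCusp => exact isElemOp_deCusp_transfer hC I hI I' h
  | deOrb => exact isElemOp_deOrb_transfer I I' h

/-- Every `Π_E`-chain is `φ`-isomorphic to a `Π_F`-chain (for corresponding cuspidal data): the
transported chain has terms `transportTerms` (`Π_F` at index `0`, the transported terms elsewhere), the
same type-chain, and its elementary operations are the transferred ones.
[cite: MochizukiAbsTopI2012, Thm 4.7 (ii) p.57] -/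
theorem exists_isoOver (C₂ : CuspidalData F) (hP₂ : IsSlimGroup F.arith) (hΔ₂ : IsSlimGroup F.geom)
    (hne₂ : F.geom ≠ ⊥) (hC : CuspidalDataCompat φ C₁ C₂) (c : E.PiChain C₁ hP₁ hΔ₁ hne₁) :
    ∃ c₂ : F.PiChain C₂ hP₂ hΔ₂ hne₂, PiChainIsoOver φ c c₂ := by
  let T : TargetData F := ⟨C₂, hP₂, hΔ₂, hne₂⟩
  refine ⟨{ len := c.len
            term := transportTerms φ T c
            term_zero := rfl
            types := c.types
            isElemOp := fun j =>
              isElemOp_transfer_all φ hC (transportTermsIso φ T c j.castSucc)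
                (transportTermsIso_isStrict φ T c j.castSucc) (transportTermsIso φ T c j.succ)
                (c.isElemOp j) }, rfl, fun j₁ j₂ hj => ?_, fun j₁ j₂ hj => ?_⟩
  · have : j₁ = j₂ := Fin.ext hj
    subst this
    rfl
  · have : j₁ = j₂ := Fin.ext hj
    subst this
    exact ⟨transportTermsIso φ T c j₁⟩

/-- In particular every `ÉtLoc(Π_E)`-object is `φ`-isomorphic to an `ÉtLoc(Π_F)`-object
(`ÉtLoc(Π) = Chain^{iso-trm}(Π){⋏, ⋎}`, [AbsTopI] Def 4.2 (v)) — the category [AbsTopII] Cor 3.3 (i) /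
3.7 invoke. [cite: MochizukiAbsTopI2012, Thm 4.7 (ii) p.57] -/
theorem exists_isoOver_of_isEtLocObj (C₂ : CuspidalData F) (hP₂ : IsSlimGroup F.arith)
    (hΔ₂ : IsSlimGroup F.geom) (hne₂ : F.geom ≠ ⊥) (hC : CuspidalDataCompat φ C₁ C₂)
    (c : E.PiChain C₁ hP₁ hΔ₁ hne₁) (hc : c.IsEtLocObj) :
    ∃ c₂ : F.PiChain C₂ hP₂ hΔ₂ hne₂, PiChainIsoOver φ c c₂ ∧ c₂.IsEtLocObj := by
  obtain ⟨c₂, h⟩ := exists_isoOver φ C₂ hP₂ hΔ₂ hne₂ hC c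
  exact ⟨c₂, h, (h.typesAmong_iff _).mp hc⟩

end Full

/-- **[AbsTopI] Theorem 4.7 (ii) holds** for the Π-chains of `AbsTopIChains.lean`, exactly as typed in
`SemiAbsoluteChains.lean` (`Thm_4_7_ii`): an isomorphism of extensions `φ : E ≅ F` (with corresponding
cuspidal data) induces a bijection of isomorphism classes `Chain(Π_E) ↔ Chain(Π_F)` compatible with
type-chains and terminal isomorphisms — PROVED by transport of structure (objects: `exists_isoOver`
along `φ` and `φ.symm`; morphisms: `thm_4_7_ii_morphisms`).  The named fact is DISCHARGED.
[cite: MochizukiAbsTopI2012, Thm 4.7 (ii) p.57] -/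
theorem thm_4_7_ii_holds : Thm_4_7_ii.{u} := by
  intro E F φ C₁ C₂ hP₁ hΔ₁ hne₁ hP₂ hΔ₂ hne₂ hC
  refine ⟨fun c₁ => exists_isoOver φ C₂ hP₂ hΔ₂ hne₂ hC c₁, fun c₂ => ?_,
    fun c₁ c₁' c₂ c₂' h h' => thm_4_7_ii_morphisms φ c₁ c₁' c₂ c₂' h h'⟩
  obtain ⟨c₁, h⟩ := exists_isoOver φ.symm C₁ hP₁ hΔ₁ hne₁ hC.symm c₂
  exact ⟨c₁, PiChainIsoOver.of_eq (by simp) h.symm⟩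
end Literature.AnabelianGeometry.AbsoluteAnabelian.AbsTopI
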